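import Literature.AlgebraicGeometry.Morphisms.FiniteBaseChangeAffine
import Mathlib.AlgebraicGeometry.Morphisms.Etale
import Mathlib.RingTheory.Unramified.Field
import HarnessLib

/-!
# A finite scheme over an affine base with UNRAMIFIED fibre over a field point has reduced fibre algebra `Ω ⊗_R Γ(P, ⊤)`
# ([StacksProject] Tag 02G3 (unramified morphisms), Tag 00U3 (étale over a field is a product of separable extensions),
# Tag 01U2; [GortzWedhorn2020] Ch. 12, Ch. 18)

Topic `Literature/AlgebraicGeometry/Morphisms`, namespace `Literature.AlgebraicGeometry.Morphisms`.  THEOREMS only (no def, no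
instance, no notation, no named fact, no `sorry`); imports ★ `FiniteBaseChangeAffine` (p799830) + Mathlib.  Cell `hodgecm-mathlib`
(D-0151), FLOOR 0, programme F0P5a, crux item stmt-HodgeConjecture-24832 — (S-γ2) consumer-side row (β) «ÉTALE GENERIC FIBRE ⇒ `hred`»
(F0P5a-p05 (g2) offer 2026-08-31T01:11:41Z; F0P5a LEAD WORDS #11/#12; MOD-PLAN row L5.5a): the (S-γ2) count theorems (★
`Literature.RingTheory.Etale.card_algHom_eq_finrank_of_isReduced_baseChange`, ★ `ValuationSubring.card_algHom_residue_comp_eq`) carry the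
hypothesis `IsReduced (Ω ⊗[R] B)` for the fibre algebra `B = Γ(P, ⊤)` of a finite `q : P ⟶ Spec R`; this file DISCHARGES it from the
scheme-level statement «the fibre of `q` over the field point `Spec Ω → Spec R` is (formally) UNRAMIFIED» — in particular ÉTALE — which is
how every road states «the generic fibre `T_K → X_K` of the finite flat correspondence is étale».

* §1 algebra: `Ω ⊗[R] B` is reduced as soon as it is a formally unramified `Ω`-algebra (`B` module-finite over `R`, `Ω` a field; Mathlib
  `Algebra.FormallyUnramified.isReduced_of_field`), in particular when `B` itself is formally unramified over `R` (base change);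
* §2 schemes: for `q : P ⟶ Spec R` FINITE and `i : R ⟶ Ω` to a field, the fibre `pullback.fst (Spec.map i) q : (Spec Ω) ×_{Spec R} P ⟶ Spec Ω`
  is, up to the isomorphism `P ≅ Spec Γ(P, ⊤)` over `Spec R` (★ `isoSpec_hom_SpecMap_eq`) and Mathlib's `pullbackSpecIso`, `Spec` of
  `algebraMap Ω (Ω ⊗[R] Γ(P, ⊤))` (`formallyUnramified_SpecMap_algebraMap_tensor`); hence **`isReduced_tensor_sections_of_formallyUnramified_fst`**:
  `FormallyUnramified (pullback.fst (Spec.map i) q) → IsReduced (Ω ⊗[R] Γ(P, ⊤))`, with the `snd`-orientation and the `Etale` corollaries;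
* §3 the case of record (★ `FiniteBaseChangeAffine` §4): `g : Y ⟶ Z` finite, `s : Spec R ⟶ Z`, and the fibre of `g` over the composite
  field point `Spec Ω → Spec R → Z` unramified ⇒ `IsReduced (Ω ⊗[R] Γ(pullback g s, ⊤))` (pasting `pullbackLeftPullbackSndIso`).

Algebra structures throughout: `((Scheme.ΓSpecIso R).inv ≫ q.appTop).hom.toAlgebra` on `Γ(P, ⊤)` (as in ★ `FiniteBaseChangeAffine`) and
`i.hom.toAlgebra` on `Ω`.  HC_CM is proved only modulo the 7 printed citations until rung 0 closes; this file is a generic leaf and changes no count.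

## References
* [StacksProject] The Stacks Project, Tag 02G3 (unramified morphisms; stable under base change), Tag 00U3 (étale / unramified algebras
  over a field are products of finite separable extensions, hence reduced), Tag 01U2 (flat morphisms), Tag 01I1 (morphisms into affine
  schemes).
* [GortzWedhorn2020] U. Görtz, T. Wedhorn, *Algebraic Geometry I*, 2nd ed. (2020), Ch. 12 (finite morphisms), Ch. 4 (fibre products) —
  background only; the tagged locators are Stacks tags.
-/

set_option autoImplicit false

noncomputable section

open CategoryTheory CategoryTheory.Limits AlgebraicGeometry TensorProduct

universe u

namespace Literature.AlgebraicGeometry.Morphisms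

/-! ### §1 Algebra: unramified fibre algebras over a field are reduced -/

section Algebra

variable (R B Ω : Type u) [CommRing R] [CommRing B] [Algebra R B] [Field Ω] [Algebra R Ω]

/-- **An unramified finite algebra over a field is reduced**, fibre form: if `B` is module-finite over `R` and the fibre algebra
`Ω ⊗[R] B` is formally unramified over the field `Ω`, then `Ω ⊗[R] B` is reduced (it is a finite product of finite separable field
extensions of `Ω`; Mathlib `Algebra.FormallyUnramified.isReduced_of_field`, the `EssFiniteType` instance coming from finiteness by base
change). [cite: StacksProject, Tag 00U3] -/
theorem isReduced_tensorProduct_of_formallyUnramified [Module.Finite R B] [Algebra.FormallyUnramified Ω (Ω ⊗[R] B)] :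
    IsReduced (Ω ⊗[R] B) :=
  Algebra.FormallyUnramified.isReduced_of_field Ω (Ω ⊗[R] B)

/-- If `B` is module-finite and formally unramified over `R` then every fibre algebra `Ω ⊗[R] B` over a field `Ω` is reduced
(unramified is stable under base change). [cite: StacksProject, Tag 02G3] [cite: StacksProject, Tag 00U3] -/
theorem isReduced_tensorProduct_of_formallyUnramified_base [Module.Finite R B] [Algebra.FormallyUnramified R B] :
    IsReduced (Ω ⊗[R] B) :=
  isReduced_tensorProduct_of_formallyUnramified R B Ω

end Algebra

/-! ### §2 Schemes: the fibre of a finite `q : P ⟶ Spec R` over a field point of the base -/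

section Scheme

variable {P : Scheme.{u}} {R : CommRingCat.{u}} (q : P ⟶ Spec R) {Ω : Type u} [Field Ω] (i : R ⟶ CommRingCat.of Ω)

/-- **The fibre of a finite `q : P ⟶ Spec R` over the field point `Spec Ω → Spec R` is `Spec (Ω ⊗[R] Γ(P, ⊤)) → Spec Ω` up to isomorphism**,
in the form the morphism classes consume: if `pullback.fst (Spec.map i) q` is formally unramified then so is
`Spec.map (algebraMap Ω (Ω ⊗[R] Γ(P, ⊤)))` (transport along `pullback.map` built from `P.isoSpec` over `Spec R`, ★ `isoSpec_hom_SpecMap_eq`,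
and Mathlib's `pullbackSpecIso R Ω Γ(P, ⊤)`; formally unramified respects isomorphisms). [cite: StacksProject, Tag 02G3] [cite: StacksProject, Tag 01I1] -/
theorem formallyUnramified_SpecMap_algebraMap_tensor [IsFinite q] [FormallyUnramified (pullback.fst (Spec.map i) q)] :
    letI := ((Scheme.ΓSpecIso R).inv ≫ q.appTop).hom.toAlgebra
    letI := i.hom.toAlgebra
    FormallyUnramified (Spec.map (CommRingCat.ofHom (algebraMap Ω (Ω ⊗[R] Γ(P, ⊤))))) := by
  letI instB : Algebra R Γ(P, ⊤) := ((Scheme.ΓSpecIso R).inv ≫ q.appTop).hom.toAlgebra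
  letI instΩ : Algebra R Ω := i.hom.toAlgebra
  haveI : IsAffine P := isAffine_of_isFinite q
  have hq : q ≫ 𝟙 (Spec R) = P.isoSpec.hom ≫ Spec.map (CommRingCat.ofHom (algebraMap R Γ(P, ⊤))) := by
    change q ≫ 𝟙 (Spec R) = P.isoSpec.hom ≫ Spec.map (CommRingCat.ofHom ((Scheme.ΓSpecIso R).inv ≫ q.appTop).hom)
    rw [CommRingCat.ofHom_hom, Category.comp_id]
    exact (isoSpec_hom_SpecMap_eq q).symm
  have hi : Spec.map i ≫ 𝟙 (Spec R) = 𝟙 _ ≫ Spec.map (CommRingCat.ofHom (algebraMap R Ω)) := by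
    change Spec.map i ≫ 𝟙 (Spec R) = 𝟙 _ ≫ Spec.map (CommRingCat.ofHom i.hom)
    rw [CommRingCat.ofHom_hom, Category.comp_id, Category.id_comp]
  let m := pullback.map (Spec.map i) q (Spec.map (CommRingCat.ofHom (algebraMap R Ω)))
    (Spec.map (CommRingCat.ofHom (algebraMap R Γ(P, ⊤)))) (𝟙 _) P.isoSpec.hom (𝟙 _) hi hq
  have hm : m ≫ pullback.fst _ _ = pullback.fst (Spec.map i) q ≫ 𝟙 _ := pullback.lift_fst _ _ _
  have key : Spec.map (CommRingCat.ofHom (algebraMap Ω (Ω ⊗[R] Γ(P, ⊤)))) =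
      (pullbackSpecIso R Ω Γ(P, ⊤)).inv ≫ inv m ≫ pullback.fst (Spec.map i) q := by
    rw [← pullbackSpecIso_inv_fst' R Ω Γ(P, ⊤)]
    congr 1
    rw [IsIso.eq_inv_comp, hm, Category.comp_id]
  rw [key, MorphismProperty.cancel_left_of_respectsIso @FormallyUnramified,
    MorphismProperty.cancel_left_of_respectsIso @FormallyUnramified]
  infer_instance

/-- **Unramified fibre ⇒ reduced fibre algebra** (`fst`-orientation): for `q : P ⟶ Spec R` finite and `i : R ⟶ Ω` to a field, if the fibre
`(Spec Ω) ×_{Spec R} P ⟶ Spec Ω` is formally unramified then `Ω ⊗[R] Γ(P, ⊤)` is reduced — the hypothesis `hred` of the (S-γ2) point counts.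
[cite: StacksProject, Tag 00U3] [cite: StacksProject, Tag 02G3] -/
theorem isReduced_tensor_sections_of_formallyUnramified_fst [IsFinite q] [FormallyUnramified (pullback.fst (Spec.map i) q)] :
    letI := ((Scheme.ΓSpecIso R).inv ≫ q.appTop).hom.toAlgebra
    letI := i.hom.toAlgebra
    IsReduced (Ω ⊗[R] Γ(P, ⊤)) := by
  letI instB : Algebra R Γ(P, ⊤) := ((Scheme.ΓSpecIso R).inv ≫ q.appTop).hom.toAlgebra
  letI instΩ : Algebra R Ω := i.hom.toAlgebra
  haveI : Module.Finite R Γ(P, ⊤) := moduleFinite_sections q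
  have hSpec := formallyUnramified_SpecMap_algebraMap_tensor q i
  have hRing : (algebraMap Ω (Ω ⊗[R] Γ(P, ⊤))).FormallyUnramified := by
    have h := (HasRingHomProperty.Spec_iff (P := @FormallyUnramified)).mp hSpec
    rwa [CommRingCat.hom_ofHom] at h
  haveI : Algebra.FormallyUnramified Ω (Ω ⊗[R] Γ(P, ⊤)) := RingHom.formallyUnramified_algebraMap.mp hRing
  exact isReduced_tensorProduct_of_formallyUnramified R Γ(P, ⊤) Ω

/-- The fibre over a field point in the `snd`-orientation is formally unramified iff it is in the `fst`-orientation (`pullbackSymmetry`).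
[cite: StacksProject, Tag 02G3] -/
theorem formallyUnramified_fst_of_snd [FormallyUnramified (pullback.snd q (Spec.map i))] :
    FormallyUnramified (pullback.fst (Spec.map i) q) := by
  rw [← pullbackSymmetry_hom_comp_snd (Spec.map i) q, MorphismProperty.cancel_left_of_respectsIso @FormallyUnramified]
  infer_instance

/-- **Unramified fibre ⇒ reduced fibre algebra** (`snd`-orientation): if `P ×_{Spec R} (Spec Ω) ⟶ Spec Ω` is formally unramified then
`Ω ⊗[R] Γ(P, ⊤)` is reduced. [cite: StacksProject, Tag 00U3] [cite: StacksProject, Tag 02G3] -/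
theorem isReduced_tensor_sections_of_formallyUnramified_snd [IsFinite q] [FormallyUnramified (pullback.snd q (Spec.map i))] :
    letI := ((Scheme.ΓSpecIso R).inv ≫ q.appTop).hom.toAlgebra
    letI := i.hom.toAlgebra
    IsReduced (Ω ⊗[R] Γ(P, ⊤)) := by
  haveI := formallyUnramified_fst_of_snd q i
  exact isReduced_tensor_sections_of_formallyUnramified_fst q i

/-- **Étale fibre ⇒ reduced fibre algebra**: if the fibre `(Spec Ω) ×_{Spec R} P ⟶ Spec Ω` of a finite `q : P ⟶ Spec R` is ÉTALE then
`Ω ⊗[R] Γ(P, ⊤)` is reduced (étale ⇒ formally unramified). [cite: StacksProject, Tag 00U3] -/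
theorem isReduced_tensor_sections_of_etale_fst [IsFinite q] [Etale (pullback.fst (Spec.map i) q)] :
    letI := ((Scheme.ΓSpecIso R).inv ≫ q.appTop).hom.toAlgebra
    letI := i.hom.toAlgebra
    IsReduced (Ω ⊗[R] Γ(P, ⊤)) :=
  isReduced_tensor_sections_of_formallyUnramified_fst q i

/-- If `q` itself is formally unramified (e.g. finite étale) then every field-point fibre algebra `Ω ⊗[R] Γ(P, ⊤)` is reduced (base change).
[cite: StacksProject, Tag 02G3] [cite: StacksProject, Tag 00U3] -/
theorem isReduced_tensor_sections_of_formallyUnramified [IsFinite q] [FormallyUnramified q] :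
    letI := ((Scheme.ΓSpecIso R).inv ≫ q.appTop).hom.toAlgebra
    letI := i.hom.toAlgebra
    IsReduced (Ω ⊗[R] Γ(P, ⊤)) := by
  haveI : FormallyUnramified (pullback.snd q (Spec.map i)) := MorphismProperty.pullback_snd _ _ inferInstance
  exact isReduced_tensor_sections_of_formallyUnramified_snd q i

end Scheme

/-! ### §3 The case of record: the fibre algebra of the base change of a finite `g : Y ⟶ Z` along `s : Spec R ⟶ Z` -/

section BaseChange

variable {Y Z : Scheme.{u}} {R : CommRingCat.{u}} (g : Y ⟶ Z) (s : Spec R ⟶ Z) {Ω : Type u} [Field Ω] (i : R ⟶ CommRingCat.of Ω)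

/-- The fibre of `pullback.snd g s : Y ×_Z Spec R ⟶ Spec R` over the field point `Spec Ω → Spec R` is formally unramified as soon as the fibre of
`g` over the composite field point `Spec Ω → Spec R → Z` is (pasting of pullback squares, Mathlib `pullbackLeftPullbackSndIso`).
[cite: StacksProject, Tag 02G3] -/
theorem formallyUnramified_snd_snd_of_fibre [FormallyUnramified (pullback.snd g (Spec.map i ≫ s))] :
    FormallyUnramified (pullback.snd (pullback.snd g s) (Spec.map i)) := by
  rw [← pullbackLeftPullbackSndIso_hom_snd g s (Spec.map i), MorphismProperty.cancel_left_of_respectsIso @FormallyUnramified]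
  infer_instance

/-- **Unramified (e.g. étale) fibre of a finite `g : Y ⟶ Z` over the geometric point `Spec Ω → Spec R → Z` ⇒ the fibre algebra
`Ω ⊗[R] Γ(Y ×_Z Spec R, ⊤)` of the base change is reduced** — the `hred` hypothesis of the (S-γ2) point counts for the finite flat
correspondence base-changed to the valuation ring of the point. [cite: StacksProject, Tag 00U3] [cite: StacksProject, Tag 02G3] -/
theorem isReduced_tensor_sections_pullback_of_formallyUnramified_fibre [IsFinite g]
    [FormallyUnramified (pullback.snd g (Spec.map i ≫ s))] :
    letI := ((Scheme.ΓSpecIso R).inv ≫ (pullback.snd g s).appTop).hom.toAlgebra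
    letI := i.hom.toAlgebra
    IsReduced (Ω ⊗[R] Γ(pullback g s, ⊤)) := by
  haveI := formallyUnramified_snd_snd_of_fibre g s i
  exact isReduced_tensor_sections_of_formallyUnramified_snd (pullback.snd g s) i

/-- The same with an ÉTALE fibre. [cite: StacksProject, Tag 00U3] -/
theorem isReduced_tensor_sections_pullback_of_etale_fibre [IsFinite g] [Etale (pullback.snd g (Spec.map i ≫ s))] :
    letI := ((Scheme.ΓSpecIso R).inv ≫ (pullback.snd g s).appTop).hom.toAlgebra
    letI := i.hom.toAlgebra
    IsReduced (Ω ⊗[R] Γ(pullback g s, ⊤)) :=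
  isReduced_tensor_sections_pullback_of_formallyUnramified_fibre g s i

/-- The same when `g` is formally unramified everywhere (e.g. a finite étale level map of a curve tower): all field-point fibre algebras of
all base changes `Y ×_Z Spec R` are reduced. [cite: StacksProject, Tag 02G3] [cite: StacksProject, Tag 00U3] -/
theorem isReduced_tensor_sections_pullback_of_formallyUnramified [IsFinite g] [FormallyUnramified g] :
    letI := ((Scheme.ΓSpecIso R).inv ≫ (pullback.snd g s).appTop).hom.toAlgebra
    letI := i.hom.toAlgebra
    IsReduced (Ω ⊗[R] Γ(pullback g s, ⊤)) := by
  haveI : FormallyUnramified (pullback.snd g s) := MorphismProperty.pullback_snd _ _ inferInstance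
  exact isReduced_tensor_sections_of_formallyUnramified (pullback.snd g s) i

end BaseChange

end Literature.AlgebraicGeometry.Morphisms

end
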